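/-
Origin: expansion seat `planner-pub-hodgecm-pv06-0`, handover (5) 2026-08-18T04:08:28Z (latest in place at cutoff) (`HOME/pub-hodgecm-pv06/lean/Pv06/PerL34/CharCompleteness.lean`, md5 4ba8c883, 213 lines);
landed by the gen-5 packager in gate run 21 as `HodgeCM/PerL34/CharCompleteness.lean` (verbatim).
-/
/-
  pub-hodgecm — DAG node N23c (PerL v5 Prop. 3.6 Step 2, tex ll. 428–430), KERNEL SUPPLEMENT 3 (pv06):
  "a continuous function on the compact group `[T]` all of whose Fourier coefficients vanish is zero"
  — the content of the `[PRINT]` field `fourier` of `HodgeCM.PerL34.Annihilation.AnnihilationDatum`,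
  REDUCED IN THE KERNEL to the classical point-separation theorem (Pontryagin–van Kampen: the
  continuous unitary characters of a locally compact abelian group separate its points — held, verified
  locator: Deitmar–Echterhoff, *Principles of Harmonic Analysis*, 2nd ed. (Springer 2014), Prop. 3.5.2,
  "if 1 ≠ x ∈ A there exists some χ ∈ Â such that χ(x) ≠ 1" [doi:10.1007/978-3-319-05792-7, PDF p. 117];
  also Hewitt–Ross I §22, Folland §4.3), via Mathlib's Stone–Weierstrass theorem
  (`ContinuousMap.starSubalgebra_topologicalClosure_eq_top_of_separatesPoints`).

  * `spanStarSubalgebra` — the ℂ-span of a family `S ⊆ C(K, ℂ)` that contains `1` and is closed under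
    products and `star` is a star-subalgebra;
  * `eq_zero_of_orthogonal_separating_family` — `K` compact, `μ` finite and positive on opens: if such
    a family `S` separates the points of `K` and `x ∈ C(K, ℂ)` satisfies `∫ star(s)·x dμ = 0` for all
    `s ∈ S`, then `x = 0` (density of `span S` in sup norm + continuity of `p ↦ ∫ star(p)·x dμ` gives
    `∫ ‖x‖² dμ = 0`);
  * `eq_zero_of_forall_character_orthogonal` — the same with `S` = the continuous unitary characters
    `PontryaginDual K` of a compact topological group `K`, under the PRINT hypothesis that they separate
    points (true for `K` abelian; it is the only non-kernel input left in the `fourier` field besides the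
    model's identification of `[T]`, its Haar probability measure and the coefficient functionals).

  `import Mathlib` only.  Nothing posited.
-/
import Mathlib
import Literature.RepresentationTheory.CompactGroups.CharacterCompleteness

/-! PORT of `HodgeCM/PerL34/CharCompleteness.lean` (HodgeCMPerL run 82) — verbatim mechanical port; provenance in the PORT header line. -/

open MeasureTheory Filter Topology

noncomputable section

namespace HodgeCM.PerL34.CharCompleteness

variable {K : Type*} [TopologicalSpace K] [CompactSpace K]

/-- The ℂ-span of a multiplicative, star-closed family containing `1` is a star-subalgebra of `C(K, ℂ)`. -/
def spanStarSubalgebra (S : Set C(K, ℂ)) (h1 : (1 : C(K, ℂ)) ∈ S)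
    (hmul : ∀ s ∈ S, ∀ t ∈ S, s * t ∈ S) (hstar : ∀ s ∈ S, star s ∈ S) :
    StarSubalgebra ℂ C(K, ℂ) where
  carrier := Submodule.span ℂ S
  mul_mem' := fun {a b} ha hb => by
    have hab : a * b ∈ Submodule.span ℂ S * Submodule.span ℂ S := Submodule.mul_mem_mul ha hb
    rw [Submodule.span_mul_span] at hab
    refine Submodule.span_mono ?_ hab
    rintro u ⟨s, hs, t, ht, rfl⟩
    exact hmul s hs t ht
  one_mem' := Submodule.subset_span h1
  add_mem' := fun ha hb => Submodule.add_mem _ ha hb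
  zero_mem' := Submodule.zero_mem _
  algebraMap_mem' := fun r => by
    rw [Algebra.algebraMap_eq_smul_one]
    exact Submodule.smul_mem _ r (Submodule.subset_span h1)
  star_mem' := fun {a} ha => by
    show star a ∈ Submodule.span ℂ S
    induction ha using Submodule.span_induction with
    | mem s hs => exact Submodule.subset_span (hstar s hs)
    | zero => rw [star_zero]; exact Submodule.zero_mem _
    | add a b _ _ ha hb => rw [star_add]; exact Submodule.add_mem _ ha hb
    | smul c a _ ha => rw [star_smul]; exact Submodule.smul_mem _ _ ha

/-- (Ported verbatim from the HodgeCMPerL package; no docstring in the source.) -/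
theorem mem_spanStarSubalgebra {S : Set C(K, ℂ)} {h1 hmul hstar} {p : C(K, ℂ)} :
    p ∈ spanStarSubalgebra S h1 hmul hstar ↔ p ∈ Submodule.span ℂ S := Iff.rfl

section Family

variable [MeasurableSpace K] [OpensMeasurableSpace K] (μ : Measure K) [IsFiniteMeasure μ]
  [μ.IsOpenPosMeasure]

/-- **Completeness from separation.**  On a compact space with a finite measure positive on opens, a
continuous function orthogonal to a point-separating, multiplicative, star-closed family containing `1`
vanishes identically. -/
alias eq_zero_of_orthogonal_separating_family := Literature.RepresentationTheory.CompactGroups.eq_zero_of_orthogonal_separating_family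

end Family

/-! ## Characters -/
section Characters

variable [Group K]

omit [CompactSpace K] in

/-- A continuous unitary character as an element of `C(K, ℂ)`. -/
def charCM (χ : PontryaginDual K) : C(K, ℂ) :=
  ⟨fun k => ((χ k : Circle) : ℂ), continuous_subtype_val.comp (map_continuous χ)⟩

omit [CompactSpace K] in
/-- (Ported verbatim from the HodgeCMPerL package; no docstring in the source.) -/
@[simp] theorem charCM_apply (χ : PontryaginDual K) (k : K) : charCM χ k = ((χ k : Circle) : ℂ) :=
  rfl

omit [CompactSpace K] in
/-- (Ported verbatim from the HodgeCMPerL package; no docstring in the source.) -/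
theorem charCM_one : charCM (1 : PontryaginDual K) = 1 := by
  ext k; rfl

omit [CompactSpace K] in
/-- (Ported verbatim from the HodgeCMPerL package; no docstring in the source.) -/
theorem charCM_mul (χ ψ : PontryaginDual K) : charCM χ * charCM ψ = charCM (χ * ψ) := by
  ext k
  show ((χ k : Circle) : ℂ) * ((ψ k : Circle) : ℂ) = (((χ * ψ) k : Circle) : ℂ)
  rw [← Circle.coe_mul]
  rfl

omit [CompactSpace K] in
/-- (Ported verbatim from the HodgeCMPerL package; no docstring in the source.) -/
theorem star_charCM (χ : PontryaginDual K) : star (charCM χ) = charCM χ⁻¹ := by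
  ext k
  rw [ContinuousMap.star_apply, charCM_apply, charCM_apply, Complex.star_def,
    ← Circle.coe_inv_eq_conj]
  rfl

/-- **Fourier completeness on a compact group, from point separation.**  `K` a compact topological
group with a finite measure positive on opens (e.g. its Haar probability measure); if the continuous
unitary characters separate the points of `K` ([PRINT] Pontryagin–van Kampen, for `K` abelian:
Deitmar–Echterhoff Prop. 3.5.2) and all
Fourier coefficients `∫ conj(χ)·x dμ` of `x ∈ C(K, ℂ)` vanish, then `x = 0`. -/
alias eq_zero_of_forall_character_orthogonal := Literature.RepresentationTheory.CompactGroups.eq_zero_of_forall_character_orthogonal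

end Characters

end HodgeCM.PerL34.CharCompleteness

end
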